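/-
Copyright (c) 2026 the pub-hodgecm-mathlib formalisation cell (harness21).  Prover seat hodgecm-mathlib-F0P3a-p01 (g34), req620 Track A «(D-RAM) FOUR-FRAME» squad, unit U2H:
the (ρ2b′-X) child (U2H ED. 15 :418) — SOCKET (C) (type RamM) organ (C-5b) S9-RM, part Σ1 «THE SIDE ⟺ NORM CRITERION, TYPE RamM» ((C) lead LH4-p04 (g5) LINE #6 (2)).  2026-09-04.
-/
import Summits.HodgeConjecture.HodgeConjecture.Theorems.F0P3cDyRamClassLettersRelative   -- ★ p858188 (this seat): `norm_or_anchored_of_even` (the Θ unit-norm dichotomy at even order)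
import HarnessLib

/-!
# Crux `H413`, line LH4 «(D-RAM) FOUR-FRAME» road — unit U2H, (ρ2b′-X), SOCKET (C): THE SIDE ⟺ NORM CRITERION, TYPE RamM (part Σ1 of the S9-RM sign dictionary)

Cell `hodgecm-mathlib` (D-0151), FLOOR 0, crux item H413 = `stmt-HodgeConjecture-24833`, route of record `HCCMUnconditional`; squad F0∕P3c∕LH4; registered stub served:
`F0P3cDyRamFourFrameU2H.stub_U2H_fixedPointCensus_typeTwo_unit0` ((ρ2b′-X), U2H ED. 15 :418) through the typed bottom socket (C) `SOCKET-hOCC.v1` (869d0c15; type RamM): the SIDE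
letters `hST ∕ hSE` of LH4-p06 (g5)'s ★ `…RamMTopCellsLaw.twistNear_iff_censusBit` read the sign `ε = (β, θ)_v` off the `Θ`-NORM CLASS of the sign unit; this file is the RamM
twin of LH4-p13 (g6)'s ★ F1 `F0P3cDyRamSideNormCriterionRamK.side_iff_exists_norm`.  THEOREMS ONLY (no `def`, no instance, no notation, no `sorry`); one field `K` (= `M`);
lane `--supports stmt-HodgeConjecture-24833 --as helper` (count-neutral).

WHAT THIS FILE PROVES.  `Θ, ρ` commuting involutions of `K`, `Θ` isometric; the `Θ` unit-norm dichotomy `(c₀, hdich)` (★ p857325 shape); `ϖM` a uniformiser; and the ONE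
RamM-specific letter **`hf♮ : ∃ a, Θa = a ∧ |a| = 1 ∧ ¬ ∃ e, ρe = e ∧ e·Θe = a·ρa`** («some `Θ`-fixed unit has a `K♮∕F`-norm that is not an `E∕F`-norm», i.e.
`N(U_{K♮}) ≠ N(U_E)` — in type RamK this is free because `K♮∕F` is unramified; in type RamM it is discharged at the CM place by part Σ2 `F0P3cDyRamFourthFieldNonNormUnit`):
* `norm_mul_rho_norm_eq` — `N_Θ(z)·ρ(N_Θ z) = N_Θ(z·ρz)` (`Θρ = ρΘ`);
* **`side_iff_exists_norm_ramM`** — for a `Θ`-fixed `κ` of EVEN order: `(∃ x, ∃ j : ℤ, |x| = 1 ∧ x·Θx = κ·(ϖM·ΘϖM)^j) ⟺ ∃ e, ρe = e ∧ e·Θe = κ·ρκ`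
  («`κ` is a `Θ`-norm up to the `K♮`-uniformiser `N_Θ(ϖM)` ⟺ `N_{K♮∕F}κ` is an `E∕F`-norm»): ⇒ by `norm_mul_rho_norm_eq`; ⇐ because the `hf♮`-witness `a` is a non-norm unit, so
  `κ = N_Θ(z)` or `κ = a·N_Θ(z)` (★ p858188 `norm_or_anchored_of_even`), and the second would make `a·ρa` a `Θ`-norm of the `ρ`-fixed `e∕(zρz)`.
(R-26): letters = LH4-p06's (C-2) frame (`hdich` from ★ `exists_unit_norm_dichotomy_of_isRamifiedQuadraticDatum Θ …`, even order from the Θ-datum clause 4) + `hf♮` (Σ2);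
model ℚ₂(ζ₈) ⊃ ℚ₂(i) (REF5 R5-201: `N(U_E) = {1,5}`, `N(U_{K♮}) = {1,7}` mod 8).
HONEST LABEL.  Count-neutral helper; (ρ2b′-X) stays an OPEN prover target; `HC_CM` is proved only modulo the 7 printed citations (2 remaining named inputs: hLiu418 =
`stmt-HodgeConjecture-24832`, h413 = `stmt-HodgeConjecture-24833`) until rung 0 closes.

## References
* [Serre1979] J.-P. Serre, *Local Fields*, GTM 67 (1979), Ch. V §3 Cor. 3 (norm index two), Ch. XIV §3–§4.
* [Kottwitz1986BaseChangeUnits] R. E. Kottwitz, *Base change for unit elements of Hecke algebras*, Compositio Math. 60 (1986), §1 pp. 240–241.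
* [Rogawski1990] J. D. Rogawski, *Automorphic Representations of Unitary Groups in Three Variables*, Ann. of Math. Stud. 123 (1990), §4.9 Prop. 4.9.1 (b) p. 55.
-/

set_option autoImplicit false

noncomputable section

open WithZero
open Summit.HodgeConjecture.HodgeConjecture.Cruxes.H413.F0P3cDyRamClassLettersRelative (norm_or_anchored_of_even)
open scoped Valued

namespace Summit.HodgeConjecture.HodgeConjecture.Cruxes.H413.F0P3cDyRamSideNormCriterionRamM

variable {K : Type} [Field K] [Valued K ℤᵐ⁰] {ρ Θ : K →+* K}

omit [Valued K ℤᵐ⁰] in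
/-- `N_Θ(z)·ρ(N_Θ z) = (z·ρz)·Θ(z·ρz)` (`Θρ = ρΘ`). [cite: Serre1979, Ch. V §3 Cor. 3] -/
theorem norm_mul_rho_norm_eq (hΘρ : ∀ x, Θ (ρ x) = ρ (Θ x)) (z : K) :
    z * Θ z * ρ (z * Θ z) = (z * ρ z) * Θ (z * ρ z) := by
  rw [map_mul, map_mul, ← hΘρ]; ring

omit [Valued K ℤᵐ⁰] in
/-- `N_Θ(ϖM)^j·ρ(N_Θ(ϖM)^j) = N_Θ(e_j)` with the `ρ`-FIXED `e_j := (ϖM·ρϖM)^j` (`Θρ = ρΘ`): the `K♮`-uniformiser class is `E∕F`-norm-neutral after `N_{K♮∕F}`. [cite: Serre1979, Ch. V §3 Cor. 3] -/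
theorem normPow_mul_rho_normPow_eq (hΘρ : ∀ x, Θ (ρ x) = ρ (Θ x)) (ϖM : K) (j : ℤ) :
    (ϖM * Θ ϖM) ^ j * ρ ((ϖM * Θ ϖM) ^ j) = (ϖM * ρ ϖM) ^ j * Θ ((ϖM * ρ ϖM) ^ j) := by
  rw [map_zpow₀, map_zpow₀, map_mul, map_mul, ← hΘρ, ← mul_zpow, ← mul_zpow]; ring_nf

/-- **THE SIDE ⟺ NORM CRITERION, TYPE RamM** («a `Θ`-fixed `κ` is a `Θ`-norm up to powers of `N_Θ(ϖM)` iff `N_{K♮∕F}κ` is an `E∕F`-norm»).  [cite: Serre1979, Ch. V §3 Cor. 3]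
[cite: Kottwitz1986BaseChangeUnits, §1 pp. 240–241] [cite: Rogawski1990, §4.9 Prop. 4.9.1 (b) p. 55] -/
theorem side_iff_exists_norm_ramM (hΘΘ : ∀ x, Θ (Θ x) = x) (hvΘ : ∀ x, Valued.v (Θ x) = Valued.v x)
    (hΘρ : ∀ x, Θ (ρ x) = ρ (Θ x)) (hρρ : ∀ x, ρ (ρ x) = x)
    {c₀ : K} (hc₀ : Valued.v c₀ = 1) (hdich : ∀ u : K, Θ u = u → Valued.v u = 1 → (∃ z : K, z * Θ z = u) ∨ ∃ z : K, z * Θ z = c₀ * u)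
    (hf : ∃ a : K, Θ a = a ∧ Valued.v a = 1 ∧ ¬ ∃ e : K, ρ e = e ∧ e * Θ e = a * ρ a)
    {ϖM : K} (hϖM : Valued.v ϖM = exp (-1 : ℤ))
    {κ : K} (hΘκ : Θ κ = κ) {n : ℤ} (hvκ : Valued.v κ = exp (2 * n)) :
    (∃ x : K, ∃ j : ℤ, Valued.v x = 1 ∧ x * Θ x = κ * (ϖM * Θ ϖM) ^ j) ↔ ∃ e : K, ρ e = e ∧ e * Θ e = κ * ρ κ := by
  have hϖ0 : ϖM ≠ 0 := fun h0 => by rw [h0, map_zero] at hϖM; exact (exp_ne_zero hϖM.symm).elim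
  have hΘϖ0 : Θ ϖM ≠ 0 := (map_ne_zero Θ).2 hϖ0
  have hκ0 : κ ≠ 0 := fun h0 => by rw [h0, map_zero] at hvκ; exact (exp_ne_zero hvκ.symm).elim
  constructor
  · -- ⇒ : `κ = N_Θ(x)·N_Θ(ϖM)^{−j} = N_Θ(x·ϖM^{−j})`, so `κρκ = N_Θ(e)` with `e := (xϖM^{−j})·ρ(xϖM^{−j})`
    rintro ⟨x, j, -, hx⟩
    set z : K := x * ϖM ^ (-j) with hz
    have hκz : κ = z * Θ z := by
      have hN0 : (ϖM * Θ ϖM) ^ j ≠ 0 := zpow_ne_zero j (mul_ne_zero hϖ0 hΘϖ0)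
      have h1 : κ = x * Θ x * ((ϖM * Θ ϖM) ^ j)⁻¹ := by rw [hx, mul_inv_cancel_right₀ hN0]
      rw [h1, hz, map_mul, map_zpow₀, ← zpow_neg, mul_zpow]; ring
    refine ⟨z * ρ z, by rw [map_mul, hρρ, mul_comm], ?_⟩
    rw [hκz, norm_mul_rho_norm_eq hΘρ]
  · -- ⇐ : the `hf♮` witness `a` is a non-norm unit; dichotomy at even order
    rintro ⟨e, hρe, he⟩
    obtain ⟨a, hΘa, ha1, haN⟩ := hf
    have ha0 : a ≠ 0 := fun h0 => by rw [h0, map_zero] at ha1; exact zero_ne_one ha1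
    have hanorm : ¬ ∃ z : K, z * Θ z = a := by
      rintro ⟨z, hz⟩
      exact haN ⟨z * ρ z, by rw [map_mul, hρρ, mul_comm], by rw [← norm_mul_rho_norm_eq hΘρ, hz]⟩
    rcases norm_or_anchored_of_even hΘΘ hvΘ hc₀ hdich hΘa ha1 hanorm hϖM hΘκ hvκ with ⟨z, hz⟩ | ⟨z, hz⟩
    · -- `κ = N_Θ(z)`: write `z = x·ϖM^k`-free: take `j := 0`? No — `z` need not be a unit; split off its order along `ϖM`.
      obtain ⟨k, hk⟩ : ∃ k : ℤ, Valued.v z = exp k := by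
        have hz0 : z ≠ 0 := fun h0 => hκ0 (by rw [← hz, h0, zero_mul])
        exact ⟨_, (exp_log ((Valuation.ne_zero_iff _).2 hz0)).symm⟩
      refine ⟨z * ϖM ^ k, k, ?_, ?_⟩
      · rw [Valuation.map_mul, map_zpow₀, hk, hϖM, ← exp_zsmul, ← exp_add, ← exp_zero]; congr 1; simp only [smul_eq_mul]; ring
      · rw [← hz, map_mul, map_zpow₀, mul_zpow]; ring
    · -- `κ = N_Θ(z)·a`: then `a·ρa = N_Θ(e ∕ (zρz))` with `e∕(zρz)` ρ-fixed — contradiction with `hf♮`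
      exfalso
      have hz0 : z ≠ 0 := fun h0 => hκ0 (by rw [← hz, h0, zero_mul, zero_mul])
      have hρz0 : ρ z ≠ 0 := (map_ne_zero ρ).2 hz0
      have hΘz0 : Θ z ≠ 0 := (map_ne_zero Θ).2 hz0
      have hΘρz0 : Θ (ρ z) ≠ 0 := (map_ne_zero Θ).2 hρz0
      apply haN
      refine ⟨e / (z * ρ z), by rw [map_div₀, hρe, map_mul, hρρ, mul_comm z], ?_⟩
      have h1 : κ * ρ κ = (z * ρ z) * Θ (z * ρ z) * (a * ρ a) := by
        rw [← hz, map_mul, map_mul, map_mul, ← hΘρ]; ring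
      rw [h1, map_mul] at he
      rw [map_div₀, map_mul]
      field_simp
      linear_combination he

end Summit.HodgeConjecture.HodgeConjecture.Cruxes.H413.F0P3cDyRamSideNormCriterionRamM

end
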